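import Literature.NumberTheory.Automorphic.CongruenceSubgroupPropertySL2Lemma4
import Literature.NumberTheory.Automorphic.CongruenceSubgroupPropertySL2AwayArith
import HarnessLib

/-!
# Serre's congruence subgroup property for `SL₂(ℤ[1/m])` — proofs, A-II: Vaserstein's Lemma 4
# over `A = ℤ[1/m]`

Topic `Literature/NumberTheory/Automorphic`; namespace `Literature.NumberTheory.Automorphic.SL2Rel.Away`.
Everything here is PROVED; no definitions, no named facts.

This file ports files X–XI of the tree's `𝓞_F` story (`CongruenceSubgroupPropertySL2Lemma4Case2.lean`,
`…Lemma4.lean`) from `A = 𝓞 K` to `A = ℤ[1/m] = Localization.Away (m : ℤ)`, `m ≥ 2`, inside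
`SL₂(F)` for any field of fractions `F ⊇ A` (`[IsFractionRing A F]`).  **Vaserstein 1972, Lemma 4**:
*for every non-zero ideal `I` and every `g ∈ GL(2, k)` the group `g E(I, I) g⁻¹` contains `E(I″, I″)`
for some non-zero ideal `I″`.*  The proofs are the tree's (Vaserstein pp. 317–318, six steps for Case 2
`g = (1 1; 0 1)`; Case 1 (diagonal) and the generation of `SL₂(F)` by transvections are the tree's
general lemmas `lemma4_diagConj`, `lemma4_trans`, `lemma4_of_swap`, `transvection_eq`); the two
arithmetic inputs are replaced as follows: the unit of infinite order is `m`
(`SerreSL2.Away.exists_unit_pow_ne_one`), and "the powers of the units generate the field" (file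
VIII) by `ℤ[m^{±N}] = ℤ[1/m]` (`SerreSL2.Away.mul_mem_of_units_pow_mul_mem`).

Main results: `SL2Rel.Away.exists_relE_le_conj_e12_one` (Case 2), `SL2Rel.Away.lemma4_conj` (every
`g ∈ SL₂(F)`), `SL2Rel.Away.exists_conj_relE_le` (the form used by Lemma 2).

## References

* [Vaserstein1972SL2] L. N. Vaserstein, Mat. Sb. 89 (131) (1972) 313–322, Lemma 4 (pp. 317–318).
* [Liehl1981SL2Orders] B. Liehl, J. reine angew. Math. 323 (1981) 153–171, end of §3.
* [SerreSL2Congruence1970] J.-P. Serre, Ann. of Math. 92 (1970), §2.6 (the case `K = ℚ`,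
  `S = {∞} ∪ {ℓ ∣ m}`).
-/

open Matrix MatrixGroups

namespace Literature.NumberTheory.Automorphic

namespace SL2Rel

/-! ### The Weyl element `w = E₁₂(-1)E₂₁(1)E₁₂(-1)` (private bookkeeping, as in file XI) -/

section Field

variable {R : Type*} [CommRing R] {F : Type*} [Field F] [Algebra R F]

/-- `w E₁₂(x) w⁻¹ = E₂₁(-x)` for the Weyl element `w = (0 -1; 1 0) = E₁₂(-1)E₂₁(1)E₁₂(-1)`. [folklore] -/
private theorem weyl_conj_e12' (x : F) : (e12 (-1) * e21 1 * e12 (-1) : SL(2, F)) * e12 x *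
    (e12 (-1) * e21 1 * e12 (-1))⁻¹ = e21 (-x) := by
  rw [mul_inv_eq_iff_eq_mul]
  ext i j
  fin_cases i <;> fin_cases j <;> simp [mul_apply_two]

/-- `w E₂₁(y) w⁻¹ = E₁₂(-y)`. [folklore] -/
private theorem weyl_conj_e21' (y : F) : (e12 (-1) * e21 1 * e12 (-1) : SL(2, F)) * e21 y *
    (e12 (-1) * e21 1 * e12 (-1))⁻¹ = e12 (-y) := by
  rw [mul_inv_eq_iff_eq_mul]
  ext i j
  fin_cases i <;> fin_cases j <;> simp [mul_apply_two]

/-- `w⁻¹ E₁₂(x) w = E₂₁(-x)`. [folklore] -/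
private theorem weyl_inv_conj_e12' (x : F) : (e12 (-1) * e21 1 * e12 (-1) : SL(2, F))⁻¹ * e12 x *
    (e12 (-1) * e21 1 * e12 (-1)) = e21 (-x) := by
  have h := weyl_conj_e21' (F := F) (-x)
  rw [neg_neg] at h
  rw [← h]; group

/-- `w⁻¹ E₂₁(y) w = E₁₂(-y)`. [folklore] -/
private theorem weyl_inv_conj_e21' (y : F) : (e12 (-1) * e21 1 * e12 (-1) : SL(2, F))⁻¹ * e21 y *
    (e12 (-1) * e21 1 * e12 (-1)) = e12 (-y) := by
  have h := weyl_conj_e12' (F := F) (-y)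
  rw [neg_neg] at h
  rw [← h]; group

/-- Lemma 4 holds for conjugation by `w`. [folklore] -/
private theorem lemma4_conj_weyl :
    ∀ I : Ideal R, I ≠ ⊥ → ∃ I'' : Ideal R, I'' ≠ ⊥ ∧
      (relE I'' I'').map (SpecialLinearGroup.map (algebraMap R F)) ≤
        ((relE I I).map (SpecialLinearGroup.map (algebraMap R F))).map
          (MulAut.conj (e12 (-1) * e21 1 * e12 (-1) : SL(2, F))).toMonoidHom :=
  lemma4_of_swap (fun x ↦ by rw [MulAut.conj_apply, weyl_conj_e12'])
    (fun y ↦ by rw [MulAut.conj_apply, weyl_conj_e21'])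

/-- Lemma 4 holds for conjugation by `w⁻¹`. [folklore] -/
private theorem lemma4_conj_weyl_inv :
    ∀ I : Ideal R, I ≠ ⊥ → ∃ I'' : Ideal R, I'' ≠ ⊥ ∧
      (relE I'' I'').map (SpecialLinearGroup.map (algebraMap R F)) ≤
        ((relE I I).map (SpecialLinearGroup.map (algebraMap R F))).map
          (MulAut.conj (e12 (-1) * e21 1 * e12 (-1) : SL(2, F)))⁻¹.toMonoidHom :=
  lemma4_of_swap (fun x ↦ by rw [MulAut.conj_inv_apply, weyl_inv_conj_e12'])
    (fun y ↦ by rw [MulAut.conj_inv_apply, weyl_inv_conj_e21'])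

end Field

namespace Away

section Away

variable {m : ℕ} {F : Type*} [Field F] [Algebra (Localization.Away (m : ℤ)) F]
  [IsFractionRing (Localization.Away (m : ℤ)) F]

/-! ### Case 2 of Lemma 4 over `ℤ[1/m]` -/

omit [IsFractionRing (Localization.Away (m : ℤ)) F] in
/-- **Vaserstein 1972, Lemma 4, Case 2** (`g = (1 1; 0 1)`) for `A = ℤ[1/m]`, `m ≥ 2` (a Dedekind
ring of arithmetic type with the unit `m` of infinite order): for every ideal `I ≠ 0` of `A` there is
an ideal `I'' ≠ 0` with `E(I'', I'') ⊆ g E(I, I) g⁻¹` in `SL₂(F)`, `F ⊇ A` a field.  The six steps of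
Vaserstein's proof (pp. 317–318), exactly as in the tree's `𝓞_K` file X; in step 6 the additive group
`X` is an `A`-ideal because `ℤ[m^{±2N₀}] = ℤ[1/m]`. [cite: Vaserstein1972SL2, Lemma 4 (Case 2)] -/
theorem exists_relE_le_conj_e12_one (hm : 2 ≤ m) {I : Ideal (Localization.Away (m : ℤ))} (hI : I ≠ ⊥) :
    ∃ I'' : Ideal (Localization.Away (m : ℤ)), I'' ≠ ⊥ ∧
      (relE I'' I'').map (SpecialLinearGroup.map (algebraMap (Localization.Away (m : ℤ)) F)) ≤
        ((relE I I).map (SpecialLinearGroup.map (algebraMap (Localization.Away (m : ℤ)) F))).map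
          (MulAut.conj (e12 (1 : F))).toMonoidHom := by
  classical
  have hm0 : m ≠ 0 := by omega
  haveI := SL2Rel.isDomain_away hm0
  set ι : SL(2, Localization.Away (m : ℤ)) →* SL(2, F) := SpecialLinearGroup.map (algebraMap (Localization.Away (m : ℤ)) F) with hι
  set f := algebraMap (Localization.Away (m : ℤ)) F with hf
  set g : SL(2, F) := e12 1 with hg
  set H := ((relE I I).map ι).map (MulAut.conj g).toMonoidHom with hH
  have hHmem : ∀ M ∈ relE I I, g * ι M * g⁻¹ ∈ H := fun M hM ↦
    Subgroup.mem_map.2 ⟨ι M, Subgroup.mem_map_of_mem _ hM, rfl⟩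
  have hιe : ∀ M : SL(2, Localization.Away (m : ℤ)), ∀ i j, (ι M) i j = f (M i j) := fun M i j ↦ rfl
  -- Step 0: `z ∈ I`, `z ≠ 0`, `1 + z ≠ 0` (`z = z₁`, or `z = 2z₁ = -2` if `z₁ = -1`)
  have h20 : (2 : Localization.Away (m : ℤ)) ≠ 0 := by
    have := natCast_ne_zero_away hm0 (show (2 : ℕ) ≠ 0 by decide)
    exact_mod_cast this
  obtain ⟨z₁, hz₁I, hz₁0⟩ := Submodule.exists_mem_ne_zero_of_ne_bot hI
  obtain ⟨z, hzI, hz0, h1z⟩ : ∃ z ∈ I, z ≠ 0 ∧ 1 + z ≠ 0 := by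
    by_cases h : 1 + z₁ = 0
    · have hz₁ : z₁ = -1 := by linear_combination h
      refine ⟨2 * z₁, I.mul_mem_left 2 hz₁I, mul_ne_zero h20 hz₁0, fun h' ↦ ?_⟩
      rw [hz₁] at h'
      exact one_ne_zero (by linear_combination -h' : (1 : Localization.Away (m : ℤ)) = 0)
    · exact ⟨z₁, hz₁I, hz₁0, h⟩
  -- Step 1: `E₁₂(x) ∈ H` for `x ∈ I`
  have h12 : ∀ x ∈ I, e12 (f x) ∈ H := by
    intro x hx
    have := hHmem (e12 x) (e12_mem_relE hx)
    rwa [hι, map_e12, hg, ← e12_neg, ← e12_add, ← e12_add,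
      show (1 : F) + algebraMap (Localization.Away (m : ℤ)) F x + -1 = f x by rw [hf]; ring] at this
  -- Step 2: the exponent `N₀`; for a unit `u ≡ 1 (mod z²)`, `U = diag(u, u⁻¹) ∈ E(I, I)`, `ι U ∈ H`
  set J : Ideal (Localization.Away (m : ℤ)) := Ideal.span {z * z} with hJ
  have hJ0 : J ≠ ⊥ := by rw [hJ, Ne, Ideal.span_singleton_eq_bot]; exact mul_ne_zero hz0 hz0
  have hJI : J ≤ I := by rw [hJ, Ideal.span_singleton_le_iff_mem]; exact I.mul_mem_left z hzI
  set N₀ : ℕ := Nat.card ((Localization.Away (m : ℤ) ⧸ J)ˣ) with hN₀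
  have hN₀0 : N₀ ≠ 0 := by
    haveI : Finite (Localization.Away (m : ℤ) ⧸ J) := SerreSL2.Away.finite_quotient_of_ne_bot hm0 hJ0
    exact Nat.card_pos.ne'
  have hdiag : ∀ u : (Localization.Away (m : ℤ))ˣ, (u : Localization.Away (m : ℤ)) - 1 ∈ J → ∃ U ∈ relE I I,
      U 0 0 = u ∧ U 0 1 = 0 ∧ U 1 0 = 0 ∧ U 1 1 = ↑u⁻¹ ∧ ι U ∈ H := by
    intro u hu
    obtain ⟨s, hs⟩ := Ideal.mem_span_singleton'.1 hu
    have hu' : (u : Localization.Away (m : ℤ)) = 1 + z * (z * s) := by linear_combination -hs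
    obtain ⟨h00, h01, h10, h11⟩ := diag_four_apply z (z * s) u hu'
    have hUE : e12 z * e21 (z * s) * e12 (-(z * ↑u⁻¹)) * e21 (-(z * s * u)) ∈ relE I I :=
      mul_mem (mul_mem (mul_mem (e12_mem_relE hzI) (e21_mem_relE (I.mul_mem_right _ hzI)))
        (e12_mem_relE (I.neg_mem (I.mul_mem_right _ hzI))))
        (e21_mem_relE (I.neg_mem (I.mul_mem_right _ (I.mul_mem_right _ hzI))))
    refine ⟨e12 z * e21 (z * s) * e12 (-(z * ↑u⁻¹)) * e21 (-(z * s * u)), hUE, h00, h01, h10, h11, ?_⟩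
    set U := e12 z * e21 (z * s) * e12 (-(z * ↑u⁻¹)) * e21 (-(z * s * u)) with hU
    -- Step 3: `g ιU g⁻¹ = ιU E₁₂(u⁻² - 1)` and `u⁻² - 1 ∈ J ⊆ I`
    have hι01 : (ι U) 0 1 = 0 := by rw [hιe, h01, map_zero]
    have hι10 : (ι U) 1 0 = 0 := by rw [hιe, h10, map_zero]
    have hconj := e12_one_mul_diag_mul_inv (ι U) hι01 hι10
    have e2 : (ι U) 1 1 * (ι U) 1 1 - 1 = f (↑u⁻¹ * ↑u⁻¹ - 1) := by
      rw [hιe, h11, map_sub, map_mul, map_one]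
    rw [e2] at hconj
    have hmem : (↑u⁻¹ * ↑u⁻¹ - 1 : Localization.Away (m : ℤ)) ∈ I := by
      apply hJI
      have e : (↑u⁻¹ * ↑u⁻¹ - 1 : Localization.Away (m : ℤ)) = -(↑u⁻¹ * ↑u⁻¹ * (u + 1)) * (u - 1) := by
        linear_combination ((u⁻¹ : (Localization.Away (m : ℤ))ˣ) * (u : Localization.Away (m : ℤ)) + 1) * u.inv_mul
      rw [e]
      exact J.mul_mem_left _ hu
    have hgU : g * ι U * g⁻¹ ∈ H := hHmem U (by rw [hU]; exact hUE)
    have e : ι U = g * ι U * g⁻¹ * (e12 (f (↑u⁻¹ * ↑u⁻¹ - 1)))⁻¹ := by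
      rw [hg, hconj, mul_inv_cancel_right]
    rw [e]
    exact H.mul_mem hgU (H.inv_mem (h12 _ hmem))
  -- Step 4: the additive group `X = {x : E₂₁(x) ∈ H}` is stable under `u²`, `u = v^{N₀}`
  let X : AddSubgroup (Localization.Away (m : ℤ)) :=
    { carrier := {x | e21 (f x) ∈ H}
      zero_mem' := by
        simp only [Set.mem_setOf_eq, map_zero, e21_zero]
        exact H.one_mem
      add_mem' := fun {a b} ha hb ↦ by
        simp only [Set.mem_setOf_eq, map_add, e21_add]
        exact H.mul_mem ha hb
      neg_mem' := fun {a} ha ↦ by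
        simp only [Set.mem_setOf_eq, map_neg, e21_neg]
        exact H.inv_mem ha }
  have hXmem : ∀ x, x ∈ X ↔ e21 (f x) ∈ H := fun x ↦ Iff.rfl
  have hX : ∀ v : (Localization.Away (m : ℤ))ˣ, ∀ x ∈ X, ((v ^ (2 * N₀) : (Localization.Away (m : ℤ))ˣ) : Localization.Away (m : ℤ)) * x ∈ X := by
    intro v x hx
    obtain ⟨U, -, h00, h01, h10, -, hUH⟩ := hdiag (v ^ N₀) (SerreSL2.Away.units_pow_card_sub_one_mem J v)
    have hι01 : (ι U) 0 1 = 0 := by rw [hιe, h01, map_zero]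
    have hι10 : (ι U) 1 0 = 0 := by rw [hιe, h10, map_zero]
    have key := diag_inv_mul_e21_mul (ι U) hι01 hι10 (f x)
    rw [hιe, h00, ← map_mul, ← map_mul] at key
    rw [hXmem, show ((v ^ (2 * N₀) : (Localization.Away (m : ℤ))ˣ) : Localization.Away (m : ℤ)) * x = ↑(v ^ N₀) * ↑(v ^ N₀) * x by
      rw [mul_comm 2, pow_mul, sq, Units.val_mul], ← key]
    exact H.mul_mem (H.mul_mem (H.inv_mem hUH) hx) hUH
  -- Step 5: a non-zero element of `X` from a unit of infinite order
  obtain ⟨v₀, hv₀⟩ := SerreSL2.Away.exists_unit_pow_ne_one hm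
  set J₁ : Ideal (Localization.Away (m : ℤ)) := Ideal.span {1 + z} with hJ₁
  have hJ₁0 : J₁ ≠ ⊥ := by rw [hJ₁, Ne, Ideal.span_singleton_eq_bot]; exact h1z
  set N₁ : ℕ := Nat.card ((Localization.Away (m : ℤ) ⧸ J₁)ˣ) with hN₁
  set u : (Localization.Away (m : ℤ))ˣ := v₀ ^ (N₀ * N₁) with hu
  have huJ : (u : Localization.Away (m : ℤ)) - 1 ∈ J := by
    rw [hu, mul_comm, pow_mul]; exact SerreSL2.Away.units_pow_card_sub_one_mem J (v₀ ^ N₁)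
  have huJ₁ : (u : Localization.Away (m : ℤ)) - 1 ∈ J₁ := by
    rw [hu, pow_mul]; exact SerreSL2.Away.units_pow_card_sub_one_mem J₁ (v₀ ^ N₀)
  obtain ⟨U, -, h00, h01, h10, h11, hUH⟩ := hdiag u huJ
  have hdvd : (u : Localization.Away (m : ℤ)) * u - 1 ∈ J₁ := by
    rw [show (u : Localization.Away (m : ℤ)) * u - 1 = (u + 1) * (u - 1) by ring]
    exact J₁.mul_mem_left _ huJ₁
  obtain ⟨t, ht⟩ := Ideal.mem_span_singleton'.1 hdvd
  -- `ht : t * (1 + z) = u * u - 1`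
  set x₀ : Localization.Away (m : ℤ) := -(↑u⁻¹ * ↑u⁻¹ * t) * z with hx₀
  have hx₀X : x₀ ∈ X := by
    rw [hXmem]
    have hι01 : (ι U) 0 1 = 0 := by rw [hιe, h01, map_zero]
    have hι10 : (ι U) 1 0 = 0 := by rw [hιe, h10, map_zero]
    have key := vaserstein_identity (ι U) hι01 hι10 (f z) (f t)
      (by rw [hιe, h00, ← map_mul, ← f.map_one, ← map_add, ← map_mul, ← map_sub, ht])
    have hgz : e12 1 * e21 (f z) * (e12 1)⁻¹ = g * ι (e21 z) * g⁻¹ := by rw [hg, hι, map_e21]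
    have hA : e12 1 * e21 (f z) * (e12 1)⁻¹ ∈ H := by rw [hgz]; exact hHmem _ (e21_mem_relE hzI)
    have hC : e12 (f t * f z) ∈ H := by rw [← map_mul]; exact h12 _ (I.mul_mem_left _ hzI)
    have lhs_mem : ι U * (e12 1 * e21 (f z) * (e12 1)⁻¹) * (ι U)⁻¹ * e12 (f t * f z) *
        (e12 1 * e21 (f z) * (e12 1)⁻¹)⁻¹ ∈ H :=
      H.mul_mem (H.mul_mem (H.mul_mem (H.mul_mem hUH hA) (H.inv_mem hUH)) hC) (H.inv_mem hA)
    rw [key, hιe, h11] at lhs_mem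
    rw [hx₀]
    simpa only [map_mul, map_neg] using lhs_mem
  have hx₀0 : x₀ ≠ 0 := by
    rw [hx₀]
    refine mul_ne_zero (neg_ne_zero.2 (mul_ne_zero (mul_ne_zero (Units.ne_zero _) (Units.ne_zero _))
      fun ht0 ↦ ?_)) hz0
    rw [ht0, zero_mul, eq_comm, sub_eq_zero] at ht
    apply hv₀ (N₀ * N₁ * 2) (mul_ne_zero (mul_ne_zero hN₀0 ?_) two_ne_zero)
    · ext
      rw [pow_mul, ← hu, Units.val_pow_eq_pow_val, sq, ht, Units.val_one]
    · haveI : Finite (Localization.Away (m : ℤ) ⧸ J₁) := SerreSL2.Away.finite_quotient_of_ne_bot hm0 hJ₁0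
      exact Nat.card_pos.ne'
  -- Step 6: `X ⊇ x₀ A` (`ℤ[m^{±2N₀}] = ℤ[1/m]`), and `I'' = (x₀ z)`
  have hNX : ∀ y, x₀ * y ∈ X :=
    SerreSL2.Away.mul_mem_of_units_pow_mul_mem (mul_ne_zero two_ne_zero hN₀0) X hX hx₀X
  refine ⟨Ideal.span {x₀ * z}, ?_, ?_⟩
  · rw [Ne, Ideal.span_singleton_eq_bot]
    exact mul_ne_zero hx₀0 hz0
  · rw [map_relE, Subgroup.closure_le]
    rintro _ (⟨x, hx, rfl⟩ | ⟨x, hx, rfl⟩)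
    · rw [SetLike.mem_coe] at hx
      obtain ⟨r, rfl⟩ := Ideal.mem_span_singleton'.1 hx
      exact h12 _ (I.mul_mem_left _ (I.mul_mem_left _ hzI))
    · rw [SetLike.mem_coe] at hx
      obtain ⟨r, rfl⟩ := Ideal.mem_span_singleton'.1 hx
      have := hNX (r * z)
      rw [hXmem] at this
      rw [SetLike.mem_coe, show r * (x₀ * z) = x₀ * (r * z) by ring]
      exact this


/-! ### Lemma 4 for every `g ∈ SL₂(F)` -/

/-- **Lemma 4, Case 2, for `E₁₂(x)`, `x ∈ F`** (`A = ℤ[1/m]`): `E₁₂(x) = diag(x, 1) E₁₂(1) diag(x, 1)⁻¹`.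
[cite: Vaserstein1972SL2, Lemma 4 (Case 2)] -/
theorem lemma4_conj_e12 (hm : 2 ≤ m) (x : F) :
    ∀ I : Ideal (Localization.Away (m : ℤ)), I ≠ ⊥ → ∃ I'' : Ideal (Localization.Away (m : ℤ)), I'' ≠ ⊥ ∧
      (relE I'' I'').map (SpecialLinearGroup.map (algebraMap (Localization.Away (m : ℤ)) F)) ≤
        ((relE I I).map (SpecialLinearGroup.map (algebraMap (Localization.Away (m : ℤ)) F))).map
          (MulAut.conj (e12 x)).toMonoidHom := by
  haveI := SL2Rel.isDomain_away (show m ≠ 0 by omega)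
  by_cases hx : x = 0
  · intro I hI
    refine ⟨I, hI, fun M hM ↦ Subgroup.mem_map.2 ⟨M, hM, ?_⟩⟩
    rw [hx, e12_zero, map_one]; rfl
  · set r : Fˣ := Units.mk0 x hx with hr
    have h2 : ∀ I : Ideal (Localization.Away (m : ℤ)), I ≠ ⊥ → ∃ I'' : Ideal (Localization.Away (m : ℤ)), I'' ≠ ⊥ ∧
        (relE I'' I'').map (SpecialLinearGroup.map (algebraMap (Localization.Away (m : ℤ)) F)) ≤
          ((relE I I).map (SpecialLinearGroup.map (algebraMap (Localization.Away (m : ℤ)) F))).map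
            (MulAut.conj (e12 (1 : F))).toMonoidHom := fun I hI ↦
      exists_relE_le_conj_e12_one hm hI
    refine lemma4_congr (lemma4_trans (lemma4_trans (lemma4_diagConj r⁻¹) h2) (lemma4_diagConj r))
      fun M ↦ ?_
    simp only [MulEquiv.trans_apply, MulAut.conj_apply]
    rw [map_mul, map_mul, map_inv, diagConj_e12, mul_one, ← diagConj_symm, MulEquiv.apply_symm_apply,
      hr, Units.val_mk0]

/-- **Lemma 4, Case 3, for `E₂₁(x)`, `x ∈ F`** (`A = ℤ[1/m]`): `E₂₁(x) = w E₁₂(-x) w⁻¹`.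
[cite: Vaserstein1972SL2, Lemma 4 (Case 3)] -/
theorem lemma4_conj_e21 (hm : 2 ≤ m) (x : F) :
    ∀ I : Ideal (Localization.Away (m : ℤ)), I ≠ ⊥ → ∃ I'' : Ideal (Localization.Away (m : ℤ)), I'' ≠ ⊥ ∧
      (relE I'' I'').map (SpecialLinearGroup.map (algebraMap (Localization.Away (m : ℤ)) F)) ≤
        ((relE I I).map (SpecialLinearGroup.map (algebraMap (Localization.Away (m : ℤ)) F))).map
          (MulAut.conj (e21 x)).toMonoidHom := by
  have h := lemma4_trans (lemma4_trans (lemma4_conj_weyl_inv (R := Localization.Away (m : ℤ)) (F := F))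
    (lemma4_conj_e12 hm (-x))) (lemma4_conj_weyl (R := Localization.Away (m : ℤ)))
  refine lemma4_congr h fun M ↦ ?_
  have hw : e21 x = (e12 (-1) * e21 1 * e12 (-1) : SL(2, F)) * e12 (-x) * (e12 (-1) * e21 1 * e12 (-1))⁻¹ := by
    rw [weyl_conj_e12', neg_neg]
  simp only [MulEquiv.trans_apply, MulAut.conj_apply, MulAut.conj_inv_apply]
  rw [hw]
  group

/-- **Vaserstein 1972, Lemma 4** for `SL₂` over `A = ℤ[1/m]`, `m ≥ 2`: for every `g ∈ SL₂(F)` (`F` the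
field of fractions) and every ideal `I ≠ 0`, the group `g E(I, I) g⁻¹` contains `E(I'', I'')` for some
ideal `I'' ≠ 0` (`SL₂(F)` is generated by the `E₁₂(x)`, `E₂₁(x)`). [cite: Vaserstein1972SL2, Lemma 4] -/
theorem lemma4_conj (hm : 2 ≤ m) (g : SL(2, F)) :
    ∀ I : Ideal (Localization.Away (m : ℤ)), I ≠ ⊥ → ∃ I'' : Ideal (Localization.Away (m : ℤ)), I'' ≠ ⊥ ∧
      (relE I'' I'').map (SpecialLinearGroup.map (algebraMap (Localization.Away (m : ℤ)) F)) ≤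
        ((relE I I).map (SpecialLinearGroup.map (algebraMap (Localization.Away (m : ℤ)) F))).map
          (MulAut.conj g).toMonoidHom := by
  refine Matrix.SL2.transvection_induction (fun g ↦
    ∀ I : Ideal (Localization.Away (m : ℤ)), I ≠ ⊥ → ∃ I'' : Ideal (Localization.Away (m : ℤ)), I'' ≠ ⊥ ∧
      (relE I'' I'').map (SpecialLinearGroup.map (algebraMap (Localization.Away (m : ℤ)) F)) ≤
        ((relE I I).map (SpecialLinearGroup.map (algebraMap (Localization.Away (m : ℤ)) F))).map
          (MulAut.conj g).toMonoidHom) ?_ ?_ g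
  · intro i j hij c
    rcases transvection_eq i j hij c with h | h <;> rw [h]
    · exact lemma4_conj_e12 hm c
    · exact lemma4_conj_e21 hm c
  · intro A B hA hB
    refine lemma4_congr (lemma4_trans hB hA) fun M ↦ ?_
    rw [MulEquiv.trans_apply, map_mul, MulAut.mul_apply]

/-- Lemma 4 in the form used below: `g E(I'', I'') g⁻¹ ⊆ E(I, I)` for some `I'' ≠ 0`.
[cite: Vaserstein1972SL2, Lemma 4] -/
theorem exists_conj_relE_le (hm : 2 ≤ m) (g : SL(2, F)) {I : Ideal (Localization.Away (m : ℤ))}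
    (hI : I ≠ ⊥) : ∃ I'' : Ideal (Localization.Away (m : ℤ)), I'' ≠ ⊥ ∧
      ∀ M ∈ relE I'' I'', ∃ E ∈ relE I I,
        SpecialLinearGroup.map (algebraMap (Localization.Away (m : ℤ)) F) E =
          g * SpecialLinearGroup.map (algebraMap (Localization.Away (m : ℤ)) F) M * g⁻¹ := by
  obtain ⟨I'', hI'', hle⟩ := lemma4_conj hm g⁻¹ I hI
  refine ⟨I'', hI'', fun M hM ↦ ?_⟩
  obtain ⟨N, hN, hNM⟩ := Subgroup.mem_map.1 (hle (Subgroup.mem_map_of_mem _ hM))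
  obtain ⟨E, hE, rfl⟩ := Subgroup.mem_map.1 hN
  refine ⟨E, hE, ?_⟩
  rw [MulEquiv.coe_toMonoidHom, MulAut.conj_apply, inv_inv] at hNM
  rw [← hNM]
  group

end Away

end Away

end SL2Rel

end Literature.NumberTheory.Automorphic
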